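import Summits.CriticalPhenomena.CardyFormulaZ2.Theorems.CardyBoundaryCoulombGasBoundaryDefectGaussianRStubRigidityOfLocalLawsPart5
import Summits.CriticalPhenomena.CardyFormulaZ2.Theorems.CardyBoundaryCoulombGasBoundaryDefectGaussianRStubReferenceLimitPart2

/-!
# Stub `stub_rigidity_of_local_laws` of line `rainbow-monomials-in-excursion-kernels` — Part 6:
# the admissibility criterion on a general lattice domain and its converse interface

Crux `BoundaryDefectGaussianR` (stmt-CriticalPhenomena-14132).

* `s3_admissible_of` — **criterion**: leg-insertion data `ι` on an arbitrary finite `V ⊂ ℤ²` is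
  admissible (`LegInsertionData.IsAdmissible`) as soon as there is a source, legs are positive,
  the sink is not a source, every insertion point is a vertex of `V` with exactly one lattice
  neighbour outside `V`, and the exterior dart of every insertion point lies on the boundary cycle
  through the sink's dart `d₀` at an index `m x < period`, indices pairwise `≥ G` apart and `≥ G`
  before the end, `G ≥ sinkLegs`. Proof: the cycle facts of Part 5 replace the explicit tour of a
  box in stub 4's `isAdmissible_of_box`; footprints / potential / parity are stub 4's Part 2
  (`pending_foldl_le`, `invariant_foldl`, `mem_walk_iff`, `getLast?_walk`).
* `s3_outDart_of_card` — a vertex with exactly one outside neighbour has `outDart V x = some (x, k)`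
  for the unique outward direction `k`;
* `s3_of_admissible` — **converse interface**: admissible data has its sink dart `d₀ = (sink, k)`
  exterior and every insertion point's exterior dart on the cycle through `d₀`.

Use along a transport path (TRANSPORT hypothesis of Part 4): from the GIVEN admissible `p_n` get
`d₀` and the indices by `s3_of_admissible`; a unit slide of a source along a flat stretch replaces
its dart by its `dsucc`-successor or -predecessor (`s3_dsucc_cases`, `s3_cycle_orbit`), index `±1`;
a slide of the sink rotates the cycle (`s3_cycle_orbit`, last clause); index gaps stay `≥ sinkLegs`
because they dominate lattice `ℓ∞`-distances (`s3_dsucc_iterate_dist`, Part 3); conclude by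
`s3_admissible_of`. No global "the boundary of `V_n` is a single cycle" theorem is needed.
-/

noncomputable section

namespace Summit.CriticalPhenomena.CardyFormulaZ2.Cruxes.BoundaryDefectGaussianR.RainbowMonomialsInExcursionKernels

open Literature.Probability.LatticeModels Literature.Probability.LatticeModels.CollarLegModel

/-- **Admissibility criterion (general lattice domain).** Leg-insertion data `ι` on `V` is admissible
as soon as: there is a source, leg numbers are positive, the sink is not a source, every insertion
point is a vertex of `V` with exactly one lattice neighbour outside `V`, and — with `d₀` the sink's
exterior dart and `P = period V d₀` — every insertion point `x` has its exterior dart ON THE BOUNDARY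
CYCLE through `d₀`, at an index `m x < P`, the indices being pairwise at least `G ≥ sinkLegs` apart and
at least `G` before the end of the cycle (so that no footprint — at most `sinkLegs` darts — overlaps
the next insertion or the end of the walk). The walk then meets every point, starts every insertion
with nothing pending, and closes up: final level `-sinkLegs + sinkLegs - Σ_sources legs = -sinkLegs`,
wired iff that is odd, nothing pending (bookkeeping of Part 2 of stub 4). This is the form in which
admissibility is checked along transport paths: the indices move by `±1` under a unit slide along a
flat stretch (`dsucc`/its inverse), and index gaps are bounded below by lattice distances. [folklore] -/
theorem s3_admissible_of :
    ∀ (ι : Literature.Probability.LatticeModels.CollarLegModel.LegInsertionData) (V : Finset (ℤ × ℤ))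
    (d₀ : Literature.Probability.LatticeModels.CollarLegModel.Dart) (m : ℤ × ℤ → ℕ) (G : ℕ),
    ι.source.Nonempty → (∀ x ∈ ι.source, 1 ≤ ι.legs x) → ι.sink ∉ ι.source →
    Literature.Probability.LatticeModels.CollarLegModel.outDart V ι.sink = some d₀ →
    (∀ x ∈ insert ι.sink ι.source, x ∈ V ∧
      ((Literature.Probability.LatticeModels.CollarLegModel.neighbours x).filter (fun y ↦ y ∉ V)).card = 1) →
    ι.sinkLegs ≤ G →
    (∀ x ∈ insert ι.sink ι.source, m x < Literature.Probability.LatticeModels.CollarLegModel.period V d₀ ∧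
      Literature.Probability.LatticeModels.CollarLegModel.outDart V x =
        some ((Literature.Probability.LatticeModels.CollarLegModel.dsucc V)^[m x] d₀)) →
    (∀ x ∈ insert ι.sink ι.source, ∀ x' ∈ insert ι.sink ι.source, m x < m x' → m x + G ≤ m x') →
    (∀ x ∈ insert ι.sink ι.source, m x + G ≤ Literature.Probability.LatticeModels.CollarLegModel.period V d₀) →
    ι.IsAdmissible V := by
  intro ι V d₀ m G hne hlegs hsink hout hpos hG hidx hgap hend
  classical
  obtain ⟨hd₀1, hd₀t⟩ := s3_outDart_some V ι.sink d₀ hout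
  have hsinkV : ι.sink ∈ V := (hpos ι.sink (Finset.mem_insert_self _ _)).1
  have hv₀ : d₀.1 ∈ V := hd₀1 ▸ hsinkV
  have ht₀ : dartTip d₀ ∉ V := by rw [dartTip, hd₀1]; exact hd₀t
  obtain ⟨hP0, -, hret, -⟩ := s3_period_spec V d₀ hv₀ ht₀
  obtain ⟨hmem, -, hall, hnodup, -, -⟩ := s3_cycle_orbit V d₀ hv₀ ht₀
  set P := period V d₀ with hP
  set f := dsucc V with hf
  have hlen : (cycle V d₀).length = P := by simp [cycle, hP]
  have hget : ∀ (t : ℕ) (ht : t < (cycle V d₀).length), (cycle V d₀)[t] = f^[t] d₀ := by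
    intro t ht; simp [cycle, hf]
  -- the vertex of the dart of an insertion point
  have hvert : ∀ x ∈ insert ι.sink ι.source, (f^[m x] d₀).1 = x := fun x hx ↦
    (s3_outDart_some V x _ (hidx x hx).2).1
  -- injectivity of indices on insertion points
  have hminj : ∀ x ∈ insert ι.sink ι.source, ∀ x' ∈ insert ι.sink ι.source, m x = m x' → x = x' := by
    intro x hx x' hx' h
    rw [← hvert x hx, ← hvert x' hx', h]
  -- the sink's index is `0`
  have hm0 : m ι.sink = 0 := by
    have h1 := (hidx ι.sink (Finset.mem_insert_self _ _)).2
    rw [hout] at h1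
    have h2 : f^[m ι.sink] d₀ = f^[0] d₀ := by
      rw [Function.iterate_zero, id_eq]; exact (Option.some.inj h1).symm
    have := (hnodup.getElem_inj_iff (hi := by rw [hlen]; exact (hidx ι.sink (Finset.mem_insert_self _ _)).1)
      (hj := by rw [hlen]; exact hP0)).1 (by rw [hget, hget]; exact h2)
    exact this
  -- a start dart on the cycle is the dart of an insertion point, with at most `G` legs
  have hstart' : ∀ (s : ℕ) (hs : s < P) (L : ℕ) (σ : ℤ), ι.startAt V (f^[s] d₀) = some (L, σ) →
      ∃ x ∈ insert ι.sink ι.source, s = m x ∧ L ≤ G ∧ (σ = 1 ∨ σ = -1) := by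
    intro s hs L σ hd
    unfold LegInsertionData.startAt at hd
    split_ifs at hd with h1 h2
    · -- the sink's dart
      refine ⟨ι.sink, Finset.mem_insert_self _ _, ?_, ?_, Or.inl ?_⟩
      · rw [hm0]
        rw [hout] at h1
        have h3 : f^[s] d₀ = f^[0] d₀ := by
          rw [Function.iterate_zero, id_eq]; exact (Option.some.inj h1).symm
        exact (hnodup.getElem_inj_iff (hi := by rw [hlen]; exact hs) (hj := by rw [hlen]; exact hP0)).1
          (by rw [hget, hget]; exact h3)
      · have := (Prod.ext_iff.1 (Option.some.inj hd)).1; simp only at this; omega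
      · have := (Prod.ext_iff.1 (Option.some.inj hd)).2; simp only at this; exact this.symm
    · -- a source's dart
      obtain ⟨hxs, hox⟩ := h2
      have hx : (f^[s] d₀).1 ∈ insert ι.sink ι.source := Finset.mem_insert_of_mem hxs
      refine ⟨(f^[s] d₀).1, hx, ?_, ?_, Or.inr ?_⟩
      · rw [(hidx _ hx).2] at hox
        have h3 : f^[s] d₀ = f^[m (f^[s] d₀).1] d₀ := (Option.some.inj hox).symm
        exact (hnodup.getElem_inj_iff (hi := by rw [hlen]; exact hs)
          (hj := by rw [hlen]; exact (hidx _ hx).1)).1 (by rw [hget, hget]; exact h3)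
      · have hL : L = ι.legs (f^[s] d₀).1 := ((Prod.ext_iff.1 (Option.some.inj hd)).1).symm
        rw [hL]
        exact (Finset.single_le_sum (fun x _ ↦ Nat.zero_le (ι.legs x)) hxs).trans hG
      · have := (Prod.ext_iff.1 (Option.some.inj hd)).2; simp only at this; exact this.symm
  -- footprints end before `T ∈ {P} ∪ {m x}`
  have hfoot : ∀ (T : ℕ), (T = P ∨ ∃ x ∈ insert ι.sink ι.source, T = m x) →
      ∀ (s : ℕ) (hs : s < T) (L : ℕ) (σ : ℤ), (hsl : s < (cycle V d₀).length) →
        ι.startAt V ((cycle V d₀)[s]) = some (L, σ) → s + L ≤ T := by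
    intro T hT s hs L σ hsl hd
    rw [hget] at hd
    obtain ⟨x, hx, rfl, hLG, -⟩ := hstart' s (hlen ▸ hsl) L σ hd
    rcases hT with rfl | ⟨x', hx', rfl⟩
    · exact (Nat.add_le_add_left hLG _).trans (hend x hx)
    · exact (Nat.add_le_add_left hLG _).trans (hgap x hx x' hx' hs)
  -- nothing pending at every start
  have hpend' : ∀ (s : ℕ) (hs : s < (cycle V d₀).length), ι.startAt V ((cycle V d₀)[s]) ≠ none →
      (List.foldl (fun s d ↦ s.step (ι.startAt V d)) ι.init ((cycle V d₀).take s)).pending = 0 := by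
    intro t ht hst
    obtain ⟨⟨L, σ⟩, hd⟩ := Option.ne_none_iff_exists'.1 hst
    rw [hget] at hd
    obtain ⟨x, hx, htx, -, -⟩ := hstart' t (hlen ▸ ht) L σ hd
    have := pending_foldl_le (ι.startAt V) ι.init rfl (cycle V d₀) t t ht.le
      (fun s hs L' σ' h ↦ hfoot t (Or.inr ⟨x, hx, htx⟩) s hs L' σ' (by omega) h)
    omega
  obtain ⟨x₁, hx₁⟩ := hne
  refine ⟨⟨x₁, hx₁⟩, hlegs, hsink, ?_, ?_, ?_⟩
  · -- every insertion point is a non-corner boundary vertex met by the walk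
    intro x hx
    refine ⟨(hpos x hx).1, (hpos x hx).2, ?_⟩
    have ht : m x < (cycle V d₀).length := hlen ▸ (hidx x hx).1
    exact ⟨_, (mem_walk_iff ι V hout).2 ⟨_, ht, rfl⟩, by rw [hget, hvert x hx]⟩
  · -- no footprint overlaps the next insertion
    intro e he hst
    obtain ⟨t, ht, rfl⟩ := (mem_walk_iff ι V hout).1 he
    exact hpend' t ht hst
  · -- the walk closes up
    have hPc : 0 < (cycle V d₀).length := by rw [hlen]; exact hP0
    rw [getLast?_walk ι V hout hPc, Option.map_some]
    have hpend : (List.foldl (fun s d ↦ s.step (ι.startAt V d)) ι.init (cycle V d₀)).pending = 0 := by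
      have := pending_foldl_le (ι.startAt V) ι.init rfl (cycle V d₀) P (cycle V d₀).length le_rfl
        (fun s hs L' σ' h ↦ hfoot _ (Or.inl rfl) s (hlen ▸ hs) L' σ' hs h)
      rw [List.take_length] at this
      omega
    have hodd : ∀ d L σ, ι.startAt V d = some (L, σ) → σ % 2 = 1 := by
      intro d L σ hd
      unfold LegInsertionData.startAt at hd
      split_ifs at hd with h1 h2
      · have := (Prod.ext_iff.1 (Option.some.inj hd)).2; simp only at this; omega
      · have := (Prod.ext_iff.1 (Option.some.inj hd)).2; simp only at this; omega
    have hinit_w : ι.init.wired = true ↔ ι.init.level % 2 = 1 := by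
      simp only [LegInsertionData.init, beq_iff_eq]; omega
    obtain ⟨hw, -, hpot⟩ := invariant_foldl (ι.startAt V) ι.init hinit_w (Or.inl rfl) hodd
      (cycle V d₀) _ le_rfl hpend'
    rw [List.take_length] at hw hpot
    rw [hpend] at hpot
    -- the contributions of the insertions add up to `sinkLegs - Σ_sources legs = 0`
    have hsum : ((cycle V d₀).map fun d ↦ (ι.startAt V d).elim 0 fun q ↦ q.2 * (q.1 : ℤ)).sum = 0 := by
      rw [← List.sum_toFinset _ hnodup]
      have hsub : (insert ι.sink ι.source).image (fun x : ℤ × ℤ ↦ f^[m x] d₀) ⊆ (cycle V d₀).toFinset := by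
        intro d hd
        rw [Finset.mem_image] at hd
        obtain ⟨x, _, rfl⟩ := hd
        rw [List.mem_toFinset]
        exact hall _
      rw [← Finset.sum_subset hsub]
      · rw [Finset.sum_image (fun x hx y hy h ↦ by
          have := congrArg Prod.fst h; rwa [hvert x hx, hvert y hy] at this), Finset.sum_insert hsink]
        have h1 : ι.startAt V (f^[m ι.sink] d₀) = some (ι.sinkLegs, 1) := by
          unfold LegInsertionData.startAt
          rw [if_pos]
          rw [hm0]
          exact hout
        have h2 : ∀ x ∈ ι.source, ι.startAt V (f^[m x] d₀) = some (ι.legs x, -1) := by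
          intro x hx
          have hx' : x ∈ insert ι.sink ι.source := Finset.mem_insert_of_mem hx
          have hne1 : ¬ outDart V ι.sink = some (f^[m x] d₀) := by
            rw [hout]
            intro h
            have h3 := congrArg Prod.fst (Option.some.inj h)
            rw [hd₀1, hvert x hx'] at h3
            exact hsink (h3 ▸ hx)
          unfold LegInsertionData.startAt
          rw [if_neg hne1, if_pos ⟨(hvert x hx').symm ▸ hx, by rw [hvert x hx']; exact (hidx x hx').2⟩,
            hvert x hx']
        rw [h1, Finset.sum_congr rfl fun x hx ↦ by rw [h2 x hx]]
        simp [LegInsertionData.sinkLegs]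
      · intro d _ hd
        rcases hsd : ι.startAt V d with _ | ⟨L, σ⟩
        · rfl
        · exfalso
          unfold LegInsertionData.startAt at hsd
          split_ifs at hsd with h1 h2
          · refine hd (Finset.mem_image.2 ⟨ι.sink, Finset.mem_insert_self _ _, ?_⟩)
            rw [hm0]
            rw [hout] at h1
            exact Option.some.inj h1
          · refine hd (Finset.mem_image.2 ⟨d.1, Finset.mem_insert_of_mem h2.1, ?_⟩)
            have := (hidx d.1 (Finset.mem_insert_of_mem h2.1)).2
            rw [h2.2] at this
            exact (Option.some.inj this).symm
    rw [hsum] at hpot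
    have hl0 : ι.init.level = -(ι.sinkLegs : ℤ) := rfl
    have hp0 : ι.init.pending = 0 := rfl
    rw [hl0, hp0] at hpot
    simp only [Nat.cast_zero, mul_zero, add_zero] at hpot
    have hwired : (List.foldl (fun s d ↦ s.step (ι.startAt V d)) ι.init (cycle V d₀)).wired =
        (ι.sinkLegs % 2 == 1) := by
      rw [Bool.eq_iff_iff, hw, hpot, beq_iff_eq]; omega
    rw [hpot, hwired, hpend]

/-- **Non-corner boundary vertices have a unique exterior dart.** If exactly one lattice neighbour
of `x` lies outside `V`, then `outDart V x = some (x, k)` for the unique direction `k` pointing out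
of `V`. [folklore] -/
theorem s3_outDart_of_card :
    ∀ (V : Finset (ℤ × ℤ)) (x : ℤ × ℤ),
    ((Literature.Probability.LatticeModels.CollarLegModel.neighbours x).filter (fun y ↦ y ∉ V)).card = 1 →
    ∃ k : Fin 4, Literature.Probability.LatticeModels.CollarLegModel.outDart V x = some (x, k) ∧
      x + Literature.Probability.LatticeModels.CollarLegModel.dir k ∉ V ∧
      ∀ k' : Fin 4, x + Literature.Probability.LatticeModels.CollarLegModel.dir k' ∉ V → k' = k := by
  intro V x hcard
  have hdir : ∀ k : Fin 4, x + dir k ∈ neighbours x := by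
    intro k
    obtain ⟨a, b⟩ := x
    fin_cases k <;> simp [dir, neighbours] <;> ring
  have hdinj : ∀ k k' : Fin 4, dir k = dir k' → k = k' := by decide
  obtain ⟨a, ha⟩ := Finset.card_eq_one.1 hcard
  have haN : a ∈ (neighbours x).filter (fun y ↦ y ∉ V) := by rw [ha]; exact Finset.mem_singleton_self a
  have huniq : ∀ y, y ∈ neighbours x → y ∉ V → y = a := by
    intro y hy hyV
    have : y ∈ (neighbours x).filter (fun y ↦ y ∉ V) := Finset.mem_filter.2 ⟨hy, hyV⟩
    rw [ha] at this
    exact Finset.mem_singleton.1 this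
  obtain ⟨haN', haV⟩ := Finset.mem_filter.1 haN
  -- `a` is `x + dir k₁` for some `k₁`
  have hex : ∃ k₁ : Fin 4, x + dir k₁ = a := by
    obtain ⟨p, q⟩ := x
    simp only [neighbours, Finset.mem_insert, Finset.mem_singleton] at haN'
    rcases haN' with rfl | rfl | rfl | rfl
    · exact ⟨0, by simp [dir]⟩
    · exact ⟨1, by simp [dir]⟩
    · exact ⟨2, by simp [dir, sub_eq_add_neg]⟩
    · exact ⟨3, by simp [dir, sub_eq_add_neg]⟩
  obtain ⟨k₁, hk₁⟩ := hex
  have hk₁V : x + dir k₁ ∉ V := hk₁ ▸ haV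
  have huk : ∀ k' : Fin 4, x + dir k' ∉ V → k' = k₁ := by
    intro k' hk'
    have h1 := huniq _ (hdir k') hk'
    rw [← hk₁] at h1
    exact hdinj _ _ (add_left_cancel h1)
  -- the `find?` defining `outDart`
  have hsome : ((List.finRange 4).find? fun k ↦ decide (x + dir k ∉ V)).isSome := by
    rw [List.find?_isSome]
    exact ⟨k₁, List.mem_finRange k₁, by simpa using hk₁V⟩
  obtain ⟨k₀, hk₀⟩ := Option.isSome_iff_exists.1 hsome
  have hk₀V : x + dir k₀ ∉ V := by simpa using List.find?_some hk₀
  have hk₀₁ : k₀ = k₁ := huk k₀ hk₀V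
  refine ⟨k₀, ?_, hk₀V, hk₀₁ ▸ huk⟩
  simp only [outDart, hk₀, Option.map_some]

/-- **What admissibility gives back.** For admissible leg-insertion data: the sink has an exterior
dart `d₀ = (sink, k)`, and every insertion point is a vertex of `V` with exactly one outside
neighbour whose exterior dart lies on the boundary cycle through `d₀` (at some index `< period`).
Together with `s3_admissible_of` this is the interface through which admissibility is transported
along unit slides and corner jumps. [folklore] -/
theorem s3_of_admissible :
    ∀ (ι : Literature.Probability.LatticeModels.CollarLegModel.LegInsertionData) (V : Finset (ℤ × ℤ)),
    ι.IsAdmissible V →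
    ∃ d₀ : Literature.Probability.LatticeModels.CollarLegModel.Dart,
      Literature.Probability.LatticeModels.CollarLegModel.outDart V ι.sink = some d₀ ∧ d₀.1 = ι.sink ∧
      d₀.1 ∈ V ∧ Literature.Probability.LatticeModels.CollarLegModel.dartTip d₀ ∉ V ∧
      ∀ x ∈ insert ι.sink ι.source, x ∈ V ∧
        ((Literature.Probability.LatticeModels.CollarLegModel.neighbours x).filter (fun y ↦ y ∉ V)).card = 1 ∧
        ∃ m, m < Literature.Probability.LatticeModels.CollarLegModel.period V d₀ ∧
          Literature.Probability.LatticeModels.CollarLegModel.outDart V x =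
            some ((Literature.Probability.LatticeModels.CollarLegModel.dsucc V)^[m] d₀) := by
  intro ι V hadm
  obtain ⟨-, -, -, h4, -, -⟩ := hadm
  obtain ⟨hsV, hscard, -⟩ := h4 ι.sink (Finset.mem_insert_self _ _)
  obtain ⟨k, hout, hkV, -⟩ := s3_outDart_of_card V ι.sink hscard
  have hv₀ : ((ι.sink, k) : Dart).1 ∈ V := hsV
  have ht₀ : dartTip ((ι.sink, k) : Dart) ∉ V := hkV
  refine ⟨(ι.sink, k), hout, rfl, hsV, hkV, fun x hx ↦ ?_⟩
  obtain ⟨hxV, hxcard, t, ht, htx⟩ := h4 x hx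
  refine ⟨hxV, hxcard, ?_⟩
  obtain ⟨s, hs, rfl⟩ := (mem_walk_iff ι V hout).1 ht
  simp only at htx
  have hlen : (cycle V ((ι.sink, k) : Dart)).length = period V (ι.sink, k) := by simp [cycle]
  have hget : (cycle V ((ι.sink, k) : Dart))[s] = (dsucc V)^[s] (ι.sink, k) := by simp [cycle]
  rw [hget] at htx
  obtain ⟨hev, het⟩ := (s3_dsucc_iterate V s).1 _ hv₀ ht₀
  obtain ⟨kx, houtx, -, huniq⟩ := s3_outDart_of_card V x hxcard
  refine ⟨s, hlen ▸ hs, ?_⟩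
  rw [houtx]
  congr 1
  have hk' : ((dsucc V)^[s] (ι.sink, k)).2 = kx := by
    apply huniq
    rw [← htx]
    exact het
  rw [← htx, ← hk']

end Summit.CriticalPhenomena.CardyFormulaZ2.Cruxes.BoundaryDefectGaussianR.RainbowMonomialsInExcursionKernels

end
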